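import Summits.Ventures.PercRepro.SixFourT4X

/-!
# PercRepro — C-025 at `(6,4)`, §22.5 IN THE KERNEL: `J₄ ≥ 0` for generic `G`, `10 ≤ g ≤ 14` (p3, gen 8)

mine-2's `MINE2-RLS.md` §22.5: summing the price certificate `(C_τ)` over the planes of a GENERIC `G` (every plane
trace `≤ 7` points, `10 ≤ g ≤ 14`) and using §22.3 (`sum_inc_mul_eq`), §22.2 (`lpp_ge`, `card_crossPairs`) and
§22.4(a) (`Xcnt_le_sum_xiProf`) inside the identity §22.1 (`J_four_identity`) gives `J₄ ≥ F(g) − y_P·C(g,2) = 0`.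
The prices satisfy `y_m·(g − m) = y_P·C(m,2) + bonus(m) + (2/3)·ε(m)·C(g − m, 2)` and `F(g) = y_P·C(g,2)` (literal
identities, `price_identity`, `Fg_eq_yP`).  Main result: `J_four_nonneg_of_generic`.
-/

namespace PercRepro.SixFour

open Finset ThmH

variable {α : Type*} [DecidableEq α] {M : Matroid α} [M.Finite] {G : Finset α}

/-! ## The price identities (literals) -/

/-- `y_m(g)·(g − m) = y_P(g)·C(m,2) + bonus(m) + (2/3)·ε(m)·C(g − m, 2)` for `10 ≤ g ≤ 14`, `2 ≤ m ≤ 6`. -/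
theorem price_identity {g m : ℕ} (hg : 10 ≤ g) (hg' : g ≤ 14) (hm : 2 ≤ m) (hm' : m ≤ 6) :
    yPrice g m * ((g - m : ℕ) : ℚ) = yP g * (m.choose 2 : ℚ) + bonus m + 2 / 3 * (eps m : ℚ) * ((g - m).choose 2 : ℚ) := by
  interval_cases g <;> interval_cases m <;> simp only [yPrice, yP, bonus, delta, eps, S3] <;> norm_num [Nat.choose]

/-- `F(g) = y_P(g)·C(g, 2)` for `10 ≤ g ≤ 14`. -/
theorem Fg_eq_yP {g : ℕ} (hg : 10 ≤ g) (hg' : g ≤ 14) : Fg g = yP g * (g.choose 2 : ℚ) := by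
  interval_cases g <;> simp only [Fg, yP, S3] <;> norm_num [Nat.choose]

/-! ## Planes with a trace of rank `≤ 2` contribute nothing -/

/-- `D₃ = 0` and `r₃(·,4) = 0` for a plane whose trace has rank `≠ 3`. -/
theorem D3_r34_eq_zero_of_ne {P : Finset α} (hP : P ∈ planes M) (hne : ¬ M.eRk ((P ∩ G : Finset α) : Set α) = 3) :
    D3 M G P = 0 ∧ r34 M G P = 0 := by
  have hle : M.eRk ((P ∩ G : Finset α) : Set α) ≤ 3 := by
    rw [← (mem_planes.1 hP).2.2]
    exact M.eRk_mono (Finset.coe_subset.2 Finset.inter_subset_left)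
  have hle2 : M.eRk ((P ∩ G : Finset α) : Set α) ≤ 2 := by
    by_contra h
    exact hne (eRk_eq_of_le_of_not_le (n := 2) hle h)
  constructor
  · unfold D3
    rw [Finset.card_eq_zero, Finset.filter_false_of_mem]
    rintro S hS ⟨-, hS3⟩
    have := M.eRk_mono (Finset.coe_subset.2 (Finset.mem_powerset.1 hS))
    rw [hS3] at this
    exact absurd (this.trans hle2) (by decide)
  · unfold r34
    rw [Finset.card_eq_zero, Finset.filter_false_of_mem]
    intro S hS hS3
    have := M.eRk_mono (Finset.coe_subset.2 (Finset.mem_powersetCard.1 hS).1)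
    rw [hS3] at this
    exact absurd (this.trans hle2) (by decide)

/-- `Σ_{P} cost ≤ Σ_{P : r(P ∩ G) = 3} cost` (the other planes have cost `0`). -/
theorem sum_cost_le (G : Finset α) :
    ∑ P ∈ planes M, cost M G P ≤
      ∑ P ∈ (planes M).filter (fun P : Finset α => M.eRk ((P ∩ G : Finset α) : Set α) = 3), cost M G P := by
  rw [← Finset.sum_filter_add_sum_filter_not (planes M)
    (fun P : Finset α => M.eRk ((P ∩ G : Finset α) : Set α) = 3) (fun P => cost M G P)]
  have h0 : ∑ P ∈ (planes M).filter (fun P : Finset α => ¬ M.eRk ((P ∩ G : Finset α) : Set α) = 3), cost M G P = 0 := by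
    refine Finset.sum_eq_zero (fun P hP => ?_)
    obtain ⟨hP, hne⟩ := Finset.mem_filter.1 hP
    obtain ⟨h1, h2⟩ := D3_r34_eq_zero_of_ne hP hne
    unfold cost
    rw [h1, h2]
    simp
  rw [h0, add_zero]

/-! ## The certificate on the rank-`3` planes, summed -/

/-- The lpp credit of the plane `P` on the lines: `Σ_ℓ ε(|ℓ ∩ ρ|)·C(p − |ℓ ∩ ρ|, 2)` (as a natural number). -/
noncomputable def lppCredit (M : Matroid α) [M.Finite] (G P : Finset α) : ℕ :=
  ∑ L ∈ lines M, eps (L ∩ (P ∩ G)).card * ((P ∩ G).card - (L ∩ (P ∩ G)).card).choose 2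

/-- One term of the right side of `(C_τ)`: `y_m·inc_m·(p − m)`. -/
noncomputable def certTerm (M : Matroid α) [M.Finite] (G P : Finset α) (g m : ℕ) : ℚ :=
  yPrice g m * (inc M (P ∩ G) m : ℚ) * (((P ∩ G).card - m : ℕ) : ℚ)

/-- The right side of `(C_τ)` for the plane `P`: `Σ_{m=2}^{6} y_m·inc_m·(p − m)`. -/
noncomputable def certRHS (M : Matroid α) [M.Finite] (G P : Finset α) (g : ℕ) : ℚ :=
  certTerm M G P g 2 + certTerm M G P g 3 + certTerm M G P g 4 + certTerm M G P g 5 + certTerm M G P g 6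

/-- `(C_τ)` for a rank-`3` plane trace, in the plane vocabulary (`g = |G|`). -/
theorem cert_plane (hs : Simple M) (hG : G ⊆ gr M) (hg : 10 ≤ G.card) (hg' : G.card ≤ 14) {P : Finset α}
    (h7 : (P ∩ G).card ≤ 7) (hr : M.eRk ((P ∩ G : Finset α) : Set α) = 3) :
    cost M G P + 6 / 5 * (xiProf G.card (P ∩ G).card (inc M (P ∩ G) 2) (inc M (P ∩ G) 3) (inc M (P ∩ G) 4)
      (inc M (P ∩ G) 5) (inc M (P ∩ G) 6) : ℚ) + 2 / 3 * (lppCredit M G P : ℚ) ≤ certRHS M G P G.card := by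
  have hc := certQ_of_trace hs hG hg hg' h7 hr
  unfold CertQ at hc
  rw [← D3_eq_D3Prof hs hG h7 hr, ← r34_eq_r34Prof hs hG h7 hr, ← sum_eps_eq_lppProf hr h7] at hc
  unfold cost certRHS certTerm lppCredit
  linarith

/-- The prices are nonnegative. -/
theorem yPrice_nonneg {g : ℕ} (hg : 10 ≤ g) (hg' : g ≤ 14) (m : ℕ) : 0 ≤ yPrice g m := by
  interval_cases g <;> (match m with
    | 2 | 3 | 4 | 5 | 6 => simp only [yPrice]; norm_num
    | 0 | 1 | n + 7 => simp only [yPrice]; norm_num)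

/-- The right side is nonnegative. -/
theorem certRHS_nonneg (G P : Finset α) {g : ℕ} (hg : 10 ≤ g) (hg' : g ≤ 14) : 0 ≤ certRHS M G P g := by
  unfold certRHS certTerm
  have := yPrice_nonneg hg hg'
  have h2 := this 2
  have h3 := this 3
  have h4 := this 4
  have h5 := this 5
  have h6 := this 6
  positivity

/-- `Σ_{P} certTerm m = y_m·(g − m)·b_m` (§22.3) for `2 ≤ m`. -/
theorem sum_certTerm_eq (hs : Simple M) (hG : G ⊆ gr M) (g : ℕ) {m : ℕ} (hm : 2 ≤ m) :
    ∑ P ∈ planes M, certTerm M G P g m = yPrice g m * ((G.card - m : ℕ) : ℚ) * (bLines M G m : ℚ) := by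
  unfold certTerm
  have h := sum_inc_mul_eq hs hG (m := m) hm
  have h' : ∑ P ∈ planes M, ((inc M (P ∩ G) m * ((P ∩ G).card - m) : ℕ) : ℚ) =
      ((G.card - m : ℕ) : ℚ) * (bLines M G m : ℚ) := by
    rw [← Nat.cast_sum, h, Nat.cast_mul]
  rw [mul_assoc, ← h', Finset.mul_sum]
  refine Finset.sum_congr rfl (fun P _ => ?_)
  push_cast
  ring

/-! ## The line side: `Σ_{m=2}^{6} f(m)·b_m ≤ Σ_ℓ f(m_ℓ)` -/

/-- A partial profile sum of `G` over `m = 2..6` is at most the full sum over the lines. -/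
theorem sum_Icc_inc_le (hg : 6 ≤ G.card) (f : ℕ → ℕ) :
    ∑ m ∈ Finset.Icc 2 6, inc M G m * f m ≤ ∑ L ∈ lines M, f (L ∩ G).card := by
  rw [sum_lines_eq_sum_inc]
  refine Finset.sum_le_sum_of_subset_of_nonneg (fun m hm => ?_) (fun _ _ _ => Nat.zero_le _)
  rw [Finset.mem_Icc] at hm
  rw [Finset.mem_range]
  omega

/-- `Σ_{m=2}^{6} C(m,2)·b_m ≤ C(g,2)`. -/
theorem sum_Icc_choose_two_le (hs : Simple M) (hG : G ⊆ gr M) (hg : 6 ≤ G.card) :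
    ∑ m ∈ Finset.Icc 2 6, inc M G m * m.choose 2 ≤ G.card.choose 2 := by
  rw [← sum_choose_two_trace hs hG]
  exact sum_Icc_inc_le hg (fun m => m.choose 2)

/-! ## The lpp credit: `Σ_ℓ ε(m_ℓ)·C(g − m_ℓ, 2) ≤ Σ_ℓ ε(m_ℓ)·#crossPairs(ℓ) + Σ_{P : r = 3} lppCredit P` -/

/-- The lpp credit of a plane whose trace has rank `≠ 3` vanishes. -/
theorem lppCredit_eq_zero_of_ne (hs : Simple M) (hG : G ⊆ gr M) {P : Finset α} (hP : P ∈ planes M)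
    (hne : ¬ M.eRk ((P ∩ G : Finset α) : Set α) = 3) : lppCredit M G P = 0 := by
  have hle : M.eRk ((P ∩ G : Finset α) : Set α) ≤ 3 := by
    rw [← (mem_planes.1 hP).2.2]
    exact M.eRk_mono (Finset.coe_subset.2 Finset.inter_subset_left)
  have hle2 : M.eRk ((P ∩ G : Finset α) : Set α) ≤ 2 := by
    by_contra h
    exact hne (eRk_eq_of_le_of_not_le (n := 2) hle h)
  unfold lppCredit
  refine Finset.sum_eq_zero (fun L hL => ?_)
  by_cases h2 : (L ∩ (P ∩ G)).card ≤ 2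
  · have : eps (L ∩ (P ∩ G)).card = 0 := by
      have he : eps 0 = 0 ∧ eps 1 = 0 ∧ eps 2 = 0 := by decide
      obtain ⟨e0, e1, e2⟩ := he
      interval_cases (L ∩ (P ∩ G)).card <;> assumption
    rw [this, zero_mul]
  · -- the trace `ρ` has rank `≤ 2` and contains `≥ 2` points of the line `L`, so `ρ ⊆ L`
    have hρL : P ∩ G ⊆ L := by
      have hr2 : M.eRk ((L ∩ (P ∩ G) : Finset α) : Set α) = 2 :=
        eRk_eq_two_of_subset_line hs hL Finset.inter_subset_left (by omega)
      have hcl := closure_eq_of_subset_line hL Finset.inter_subset_left hr2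
      -- `cl(L ∩ ρ) = L`; `ρ ⊆ cl(ρ)`, and `cl(L ∩ ρ) ⊆ cl(ρ)` with equal rank `2`
      have hρ2 : M.eRk ((P ∩ G : Finset α) : Set α) = 2 :=
        le_antisymm hle2 (by rw [← hr2]; exact M.eRk_mono (Finset.coe_subset.2 Finset.inter_subset_right))
      have hflat : M.closure ((L ∩ (P ∩ G) : Finset α) : Set α) = M.closure ((P ∩ G : Finset α) : Set α) :=
        closure_eq_of_subset_flat (M.isFlat_closure _)
          (M.subset_closure_of_subset' (Finset.coe_subset.2 Finset.inter_subset_right)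
            (by rw [← coe_gr M]; exact Finset.coe_subset.2 (Finset.inter_subset_right.trans (Finset.inter_subset_right.trans hG))))
          (Finset.finite_toSet _) (by rw [M.eRk_closure_eq, hρ2, hr2])
      intro y hy
      have : y ∈ M.closure ((P ∩ G : Finset α) : Set α) :=
        M.mem_closure_of_mem' (Finset.mem_coe.2 hy) (by rw [← coe_gr M]; exact Finset.mem_coe.2 (hG (Finset.mem_inter.1 hy).2))
      rw [← hflat, hcl] at this
      exact Finset.mem_coe.1 this
    have : L ∩ (P ∩ G) = P ∩ G := Finset.inter_eq_right.2 hρL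
    rw [this, Nat.sub_self, Nat.choose_zero_succ, mul_zero]

/-- For every plane `P`, `Σ_{ℓ ⊆ P} ε(m_ℓ)·C(|P ∩ G| − m_ℓ, 2) ≤ lppCredit P`. -/
theorem sum_lines_in_plane_le {P : Finset α} :
    ∑ L ∈ (lines M).filter (fun L : Finset α => L ⊆ P), eps (L ∩ G).card * ((P ∩ G).card - (L ∩ G).card).choose 2 ≤
      lppCredit M G P := by
  unfold lppCredit
  rw [Finset.sum_filter]
  refine Finset.sum_le_sum (fun L _ => ?_)
  split_ifs with hLP
  · have : L ∩ (P ∩ G) = L ∩ G := by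
      ext y
      simp only [Finset.mem_inter]
      exact ⟨fun h => ⟨h.1, h.2.2⟩, fun h => ⟨h.1, hLP h.1, h.2⟩⟩
    rw [this]
  · exact Nat.zero_le _

/-- `Σ_ℓ ε(m_ℓ)·C(g − m_ℓ, 2) ≤ Σ_ℓ ε(m_ℓ)·#crossPairs(ℓ) + Σ_{P : r(P ∩ G) = 3} lppCredit P`. -/
theorem sum_eps_choose_le (hs : Simple M) (hG : G ⊆ gr M) :
    ∑ L ∈ lines M, eps (L ∩ G).card * (G.card - (L ∩ G).card).choose 2 ≤
      ∑ L ∈ lines M, eps (L ∩ G).card * (crossPairs M G L).card +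
        ∑ P ∈ (planes M).filter (fun P : Finset α => M.eRk ((P ∩ G : Finset α) : Set α) = 3), lppCredit M G P := by
  -- per line: `C(g − m, 2) = #cross + #same`, `#same = Σ_{P ⊇ ℓ} C(|P ∩ G| − m, 2)`
  have hline : ∀ L ∈ lines M, eps (L ∩ G).card * (G.card - (L ∩ G).card).choose 2 =
      eps (L ∩ G).card * (crossPairs M G L).card +
        ∑ P ∈ (planes M).filter (fun P : Finset α => L ⊆ P), eps (L ∩ G).card * ((P ∩ G).card - (L ∩ G).card).choose 2 := by
    intro L hL
    rw [← Finset.mul_sum, ← mul_add, ← card_samePairs hs hG hL, crossPairs_eq_sdiff hs hG hL,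
      Finset.card_sdiff_add_card_eq_card (samePairs_subset L), Finset.card_powersetCard, Finset.card_sdiff]
  rw [Finset.sum_congr rfl hline, Finset.sum_add_distrib]
  apply Nat.add_le_add_left
  -- swap the double sum and bound plane by plane
  have key : ∀ (L P : Finset α), (L ∈ lines M ∧ P ∈ (planes M).filter (fun P : Finset α => L ⊆ P)) ↔
      (L ∈ (lines M).filter (fun L : Finset α => L ⊆ P) ∧ P ∈ planes M) := by
    intro L P
    simp only [Finset.mem_filter]
    tauto
  rw [Finset.sum_comm' key]
  calc ∑ P ∈ planes M, ∑ L ∈ (lines M).filter (fun L : Finset α => L ⊆ P),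
        eps (L ∩ G).card * ((P ∩ G).card - (L ∩ G).card).choose 2
      ≤ ∑ P ∈ planes M, lppCredit M G P := Finset.sum_le_sum (fun P _ => sum_lines_in_plane_le)
    _ = ∑ P ∈ (planes M).filter (fun P : Finset α => M.eRk ((P ∩ G : Finset α) : Set α) = 3), lppCredit M G P := by
        rw [Finset.sum_filter]
        refine Finset.sum_congr rfl (fun P hP => ?_)
        split_ifs with h
        · rfl
        · exact lppCredit_eq_zero_of_ne hs hG hP h

/-- The profile sum over the lines, rational version: `Σ_ℓ f(|ℓ ∩ G|) = Σ_{m ≤ g} b_m·f(m)`. -/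
theorem sum_lines_eq_sum_inc_rat (G : Finset α) (f : ℕ → ℚ) :
    ∑ L ∈ lines M, f (L ∩ G).card = ∑ m ∈ Finset.range (G.card + 1), (inc M G m : ℚ) * f m := by
  rw [← Finset.sum_fiberwise_of_maps_to' (g := fun L : Finset α => (L ∩ G).card) (t := Finset.range (G.card + 1))
    (fun L _ => by rw [Finset.mem_range]; exact Nat.lt_succ_of_le (Finset.card_le_card Finset.inter_subset_right))]
  refine Finset.sum_congr rfl (fun m _ => ?_)
  rw [Finset.sum_const, nsmul_eq_mul]
  rfl

/-- A partial profile sum over `m = 2..6` of a nonnegative `f` is at most the full sum over the lines (rational). -/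
theorem sum_Icc_inc_le_rat (hg : 6 ≤ G.card) (f : ℕ → ℚ) (hf : ∀ m, 0 ≤ f m) :
    ∑ m ∈ Finset.Icc 2 6, (inc M G m : ℚ) * f m ≤ ∑ L ∈ lines M, f (L ∩ G).card := by
  rw [sum_lines_eq_sum_inc_rat]
  refine Finset.sum_le_sum_of_subset_of_nonneg (fun m hm => ?_) (fun m _ _ => mul_nonneg (Nat.cast_nonneg _) (hf m))
  rw [Finset.mem_Icc] at hm
  rw [Finset.mem_range]
  omega

/-! ## §22.5: `J₄ ≥ 0` for generic `G` -/

/-- **§22.5** (mine-2): for a generic rank-`4` set `G ⊆ E` of a simple matroid with `10 ≤ g ≤ 14` points and every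
plane trace of at most `7` points, `0 ≤ J₄(G)`. -/
theorem J_four_nonneg_of_generic (hs : Simple M) (hG : G ⊆ gr M) (hr : M.eRk (G : Set α) = 4) (hgen : Generic M G)
    (hpl : ∀ P ∈ planes M, (P ∩ G).card ≤ 7) (hg : 10 ≤ G.card) (hg' : G.card ≤ 14) : 0 ≤ J M G 4 := by
  set S := (planes M).filter (fun P : Finset α => M.eRk ((P ∩ G : Finset α) : Set α) = 3) with hS
  have hg6 : 6 ≤ G.card := by omega
  -- F1: the identity
  have F1 := J_four_identity hs hG hr
  -- F2: the cost sum restricted to the rank-`3` planes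
  have F2 := sum_cost_le (M := M) G
  -- F3: the certificate summed over `S`
  have F3 : ∑ P ∈ S, cost M G P + 6 / 5 * ∑ P ∈ S, (xiProf G.card (P ∩ G).card (inc M (P ∩ G) 2) (inc M (P ∩ G) 3)
      (inc M (P ∩ G) 4) (inc M (P ∩ G) 5) (inc M (P ∩ G) 6) : ℚ) + 2 / 3 * ∑ P ∈ S, (lppCredit M G P : ℚ) ≤
      ∑ P ∈ S, certRHS M G P G.card := by
    rw [Finset.mul_sum, Finset.mul_sum, ← Finset.sum_add_distrib, ← Finset.sum_add_distrib]
    refine Finset.sum_le_sum (fun P hP => ?_)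
    obtain ⟨hP, hr3⟩ := Finset.mem_filter.1 hP
    exact cert_plane hs hG hg hg' (hpl P hP) hr3
  -- F4: extend the right side to all planes
  have F4 : ∑ P ∈ S, certRHS M G P G.card ≤ ∑ P ∈ planes M, certRHS M G P G.card :=
    Finset.sum_le_sum_of_subset_of_nonneg (Finset.filter_subset _ _) (fun P _ _ => certRHS_nonneg G P hg hg')
  -- F5 + F6: the right side as the line quantities, with the price identities
  have F56 : ∑ P ∈ planes M, certRHS M G P G.card =
      yP G.card * ∑ m ∈ Finset.Icc 2 6, (inc M G m : ℚ) * (m.choose 2 : ℚ) +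
      ∑ m ∈ Finset.Icc 2 6, (inc M G m : ℚ) * bonus m +
      2 / 3 * ∑ m ∈ Finset.Icc 2 6, (inc M G m : ℚ) * ((eps m : ℚ) * ((G.card - m).choose 2 : ℚ)) := by
    unfold certRHS
    simp only [Finset.sum_add_distrib]
    rw [sum_certTerm_eq hs hG _ (by norm_num), sum_certTerm_eq hs hG _ (by norm_num),
      sum_certTerm_eq hs hG _ (by norm_num), sum_certTerm_eq hs hG _ (by norm_num),
      sum_certTerm_eq hs hG _ (by norm_num)]
    rw [price_identity hg hg' (by norm_num) (by norm_num), price_identity hg hg' (by norm_num) (by norm_num),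
      price_identity hg hg' (by norm_num) (by norm_num), price_identity hg hg' (by norm_num) (by norm_num),
      price_identity hg hg' (by norm_num) (by norm_num)]
    rw [show Finset.Icc 2 6 = {2, 3, 4, 5, 6} from rfl]
    simp only [Finset.sum_insert (by decide : (2 : ℕ) ∉ ({3, 4, 5, 6} : Finset ℕ)),
      Finset.sum_insert (by decide : (3 : ℕ) ∉ ({4, 5, 6} : Finset ℕ)),
      Finset.sum_insert (by decide : (4 : ℕ) ∉ ({5, 6} : Finset ℕ)),
      Finset.sum_insert (by decide : (5 : ℕ) ∉ ({6} : Finset ℕ)), Finset.sum_singleton]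
    unfold bLines
    ring
  -- F7: the line-side bounds
  have F7a : ∑ m ∈ Finset.Icc 2 6, (inc M G m : ℚ) * (m.choose 2 : ℚ) ≤ (G.card.choose 2 : ℚ) := by
    have := sum_Icc_choose_two_le hs hG hg6
    have h' : ∑ m ∈ Finset.Icc 2 6, (inc M G m : ℚ) * (m.choose 2 : ℚ) =
        ((∑ m ∈ Finset.Icc 2 6, inc M G m * m.choose 2 : ℕ) : ℚ) := by push_cast; rfl
    rw [h']
    exact_mod_cast this
  have F7b : ∑ m ∈ Finset.Icc 2 6, (inc M G m : ℚ) * bonus m ≤ ∑ L ∈ lines M, bonus (L ∩ G).card :=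
    sum_Icc_inc_le_rat hg6 bonus (fun m => by unfold bonus; positivity)
  have F7c : ∑ m ∈ Finset.Icc 2 6, (inc M G m : ℚ) * ((eps m : ℚ) * ((G.card - m).choose 2 : ℚ)) ≤
      ∑ L ∈ lines M, ((eps (L ∩ G).card : ℚ) * ((G.card - (L ∩ G).card).choose 2 : ℚ)) :=
    sum_Icc_inc_le_rat hg6 (fun m => (eps m : ℚ) * ((G.card - m).choose 2 : ℚ)) (fun m => by positivity)
  -- F8: the `X` bound
  have F8 : (Xcnt M G : ℚ) ≤ ∑ P ∈ S, (xiProf G.card (P ∩ G).card (inc M (P ∩ G) 2) (inc M (P ∩ G) 3)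
      (inc M (P ∩ G) 4) (inc M (P ∩ G) 5) (inc M (P ∩ G) 6) : ℚ) := by
    have := Xcnt_le_sum_xiProf hs hG hr hgen hpl hg
    rw [← hS] at this
    exact_mod_cast this
  -- F9: the `lpp` lower bound
  have F9 : ∑ L ∈ lines M, ((eps (L ∩ G).card : ℚ) * ((crossPairs M G L).card : ℚ)) ≤ (lpp M G : ℚ) := by
    have := lpp_ge hs hG
    have h' : ∑ L ∈ lines M, ((eps (L ∩ G).card : ℚ) * ((crossPairs M G L).card : ℚ)) =
        ((∑ L ∈ lines M, eps (L ∩ G).card * (crossPairs M G L).card : ℕ) : ℚ) := by push_cast; rfl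
    rw [h']
    exact_mod_cast this
  -- F10: the lpp credit
  have F10 : ∑ L ∈ lines M, ((eps (L ∩ G).card : ℚ) * ((G.card - (L ∩ G).card).choose 2 : ℚ)) ≤
      ∑ L ∈ lines M, ((eps (L ∩ G).card : ℚ) * ((crossPairs M G L).card : ℚ)) + ∑ P ∈ S, (lppCredit M G P : ℚ) := by
    have := sum_eps_choose_le hs hG
    rw [← hS] at this
    have h1 : ∑ L ∈ lines M, ((eps (L ∩ G).card : ℚ) * ((G.card - (L ∩ G).card).choose 2 : ℚ)) =
        ((∑ L ∈ lines M, eps (L ∩ G).card * (G.card - (L ∩ G).card).choose 2 : ℕ) : ℚ) := by push_cast; rfl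
    have h2 : ∑ L ∈ lines M, ((eps (L ∩ G).card : ℚ) * ((crossPairs M G L).card : ℚ)) =
        ((∑ L ∈ lines M, eps (L ∩ G).card * (crossPairs M G L).card : ℕ) : ℚ) := by push_cast; rfl
    have h3 : ∑ P ∈ S, (lppCredit M G P : ℚ) = ((∑ P ∈ S, lppCredit M G P : ℕ) : ℚ) := by push_cast; rfl
    rw [h1, h2, h3, ← Nat.cast_add]
    exact_mod_cast this
  -- F11: `F(g) = y_P·C(g,2)`, and `y_P ≥ 0`
  have F11 := Fg_eq_yP hg hg'
  have hyP : 0 ≤ yP G.card := by interval_cases G.card <;> simp only [yP] <;> norm_num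
  have hlpp : (0 : ℚ) ≤ lpp M G := Nat.cast_nonneg _
  have hcred : (0 : ℚ) ≤ ∑ P ∈ S, (lppCredit M G P : ℚ) := Finset.sum_nonneg (fun _ _ => Nat.cast_nonneg _)
  -- assemble
  have hyPC : yP G.card * ∑ m ∈ Finset.Icc 2 6, (inc M G m : ℚ) * (m.choose 2 : ℚ) ≤ yP G.card * (G.card.choose 2 : ℚ) :=
    mul_le_mul_of_nonneg_left F7a hyP
  rw [F1]
  nlinarith [F2, F3, F4, F56, F7b, F7c, F8, F9, F10, F11, hyPC, hlpp, hcred]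

end PercRepro.SixFour
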